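import Mathlib

/-!
# Crux `MonotoneCoverHard` (stmt-ValiantsHypothesis-7421): the WIDTH PROFILE of a levelled cover is
matching-independent (B.2 of the calibration memo, kernel)

Lane BalEx (val-width-7421-p3 g0, 2026-08-27); companion of `…LevelFunction.lean` (which constructs the
level function).  For an abstract `{0,1}`-weight `V` ("variable edge") on `Fin m × Fin m` and a level
function `g : Fin m ⊕ Fin m → ℕ` (column level = row level `+ 1` across a `V`-edge of the matching, `=`
across a non-`V`-edge), two perfect matchings levelled by the same `g` have the same number of
`V`-edges leaving every row level (`card_level_var_eq`: `F_ℓ + #C_ℓ = #R_ℓ + F_{ℓ-1}` by counting the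
level-`ℓ` rows and columns through the matching, then induction on `ℓ`), hence the same number of
`V`-edges with row level in any prescribed set (`card_var_levelPred_eq`: prefix and band counts).  So
every levelled cover is a "generalised ABP" whose transition `ℓ → ℓ+1` carries the same number `c_ℓ` of
variable edges of EVERY weight-nonzero perfect matching (val-width-7421-p2's width profile; graded =
`c_ℓ ≡ 1`).  No Pfaffian hypothesis; VP ≠ VNP is not moved.  No definitions.
-/

namespace Summit.ValiantsHypothesis.ValiantsHypothesis.Theorems.PolyaContinuedMonotoneCoverHard

-- summit = sub-problem name (single-conjunct summit, D-0017 layout), so the namespace repeats it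
set_option linter.dupNamespace false

open scoped Classical
open Finset

/-- **WIDTH PROFILE (B.2), one level.**  Let `g : Fin m ⊕ Fin m → ℕ` be a level function for the
`{0,1}`-weight `V` ("variable edge") along two perfect matchings `τ, τ'` (column level = row level
`+ 1` across a `V`-edge, `=` row level across a non-`V`-edge).  Then `τ` and `τ'` have the same number
of `V`-edges leaving each row level `ℓ`: counting the level-`ℓ` rows and columns through `τ` gives
`F_ℓ(τ) + #C_ℓ = #R_ℓ + F_{ℓ-1}(τ)`, and induction on `ℓ`. -/
theorem card_level_var_eq {m : ℕ} (V : Fin m → Fin m → Prop) (g : Fin m ⊕ Fin m → ℕ)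
    (τ τ' : Equiv.Perm (Fin m))
    (hτ : ∀ i, (V i (τ i) → g (Sum.inr (τ i)) = g (Sum.inl i) + 1) ∧
      (¬ V i (τ i) → g (Sum.inr (τ i)) = g (Sum.inl i)))
    (hτ' : ∀ i, (V i (τ' i) → g (Sum.inr (τ' i)) = g (Sum.inl i) + 1) ∧
      (¬ V i (τ' i) → g (Sum.inr (τ' i)) = g (Sum.inl i)))
    (ℓ : ℕ) :
    (univ.filter fun i : Fin m => V i (τ i) ∧ g (Sum.inl i) = ℓ).card =
      (univ.filter fun i : Fin m => V i (τ' i) ∧ g (Sum.inl i) = ℓ).card := by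
  classical
  -- the counting identity, for any matching `σ` levelled by `g`
  have count : ∀ σ : Equiv.Perm (Fin m),
      (∀ i, (V i (σ i) → g (Sum.inr (σ i)) = g (Sum.inl i) + 1) ∧
        (¬ V i (σ i) → g (Sum.inr (σ i)) = g (Sum.inl i))) → ∀ ℓ,
      (univ.filter fun i : Fin m => V i (σ i) ∧ g (Sum.inl i) = ℓ).card +
          (univ.filter fun j : Fin m => g (Sum.inr j) = ℓ).card =
        (univ.filter fun i : Fin m => g (Sum.inl i) = ℓ).card +
          (univ.filter fun i : Fin m => V i (σ i) ∧ g (Sum.inl i) + 1 = ℓ).card := by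
    intro σ hσ ℓ
    -- rows of level ℓ split by `V`
    have hR : (univ.filter fun i : Fin m => g (Sum.inl i) = ℓ).card =
        (univ.filter fun i : Fin m => V i (σ i) ∧ g (Sum.inl i) = ℓ).card +
          (univ.filter fun i : Fin m => ¬ V i (σ i) ∧ g (Sum.inl i) = ℓ).card := by
      rw [← Finset.card_filter_add_card_filter_not (fun i => V i (σ i)),
        Finset.filter_filter, Finset.filter_filter]
      congr 1
      · congr 1; exact Finset.filter_congr fun i _ => and_comm
      · congr 1; exact Finset.filter_congr fun i _ => and_comm
    -- columns of level ℓ, pulled back through `σ`, split by `V`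
    have hC : (univ.filter fun j : Fin m => g (Sum.inr j) = ℓ).card =
        (univ.filter fun i : Fin m => V i (σ i) ∧ g (Sum.inl i) + 1 = ℓ).card +
          (univ.filter fun i : Fin m => ¬ V i (σ i) ∧ g (Sum.inl i) = ℓ).card := by
      have h1 : (univ.filter fun j : Fin m => g (Sum.inr j) = ℓ).card =
          (univ.filter fun i : Fin m => g (Sum.inr (σ i)) = ℓ).card := by
        symm
        exact Finset.card_equiv σ fun i => by simp
      rw [h1, ← Finset.card_filter_add_card_filter_not (fun i => V i (σ i)),
        Finset.filter_filter, Finset.filter_filter]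
      congr 1
      · congr 1
        exact Finset.filter_congr fun i _ => by
          constructor
          · rintro ⟨h1, h2⟩; exact ⟨h2, by rw [← (hσ i).1 h2]; exact h1⟩
          · rintro ⟨h2, h1⟩; exact ⟨by rw [(hσ i).1 h2]; exact h1, h2⟩
      · congr 1
        exact Finset.filter_congr fun i _ => by
          constructor
          · rintro ⟨h1, h2⟩; exact ⟨h2, by rw [← (hσ i).2 h2]; exact h1⟩
          · rintro ⟨h2, h1⟩; exact ⟨by rw [(hσ i).2 h2]; exact h1, h2⟩
    omega
  -- shift: `{V ∧ g + 1 = ℓ + 1} = {V ∧ g = ℓ}`, `{V ∧ g + 1 = 0} = ∅`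
  have shift : ∀ σ : Equiv.Perm (Fin m), ∀ ℓ,
      (univ.filter fun i : Fin m => V i (σ i) ∧ g (Sum.inl i) + 1 = ℓ + 1) =
        univ.filter fun i : Fin m => V i (σ i) ∧ g (Sum.inl i) = ℓ :=
    fun σ ℓ => Finset.filter_congr fun i _ => by simp
  have zero : ∀ σ : Equiv.Perm (Fin m),
      (univ.filter fun i : Fin m => V i (σ i) ∧ g (Sum.inl i) + 1 = 0) = ∅ :=
    fun σ => Finset.filter_eq_empty_iff.2 fun i _ h => by omega
  induction ℓ with
  | zero =>
    have h1 := count τ hτ 0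
    have h2 := count τ' hτ' 0
    rw [zero, Finset.card_empty] at h1 h2
    omega
  | succ ℓ ih =>
    have h1 := count τ hτ (ℓ + 1)
    have h2 := count τ' hτ' (ℓ + 1)
    rw [shift] at h1 h2
    omega

/-- **WIDTH PROFILE, any set of levels.**  Under the hypotheses of `card_level_var_eq`, for every
predicate `Q` on levels the number of `V`-edges of the matching whose row level satisfies `Q` is the
same for `τ` and `τ'` (in particular prefix counts `g(row) < h` and band counts `a ≤ g(row) < b`). -/
theorem card_var_levelPred_eq {m : ℕ} (V : Fin m → Fin m → Prop) (g : Fin m ⊕ Fin m → ℕ)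
    (τ τ' : Equiv.Perm (Fin m))
    (hτ : ∀ i, (V i (τ i) → g (Sum.inr (τ i)) = g (Sum.inl i) + 1) ∧
      (¬ V i (τ i) → g (Sum.inr (τ i)) = g (Sum.inl i)))
    (hτ' : ∀ i, (V i (τ' i) → g (Sum.inr (τ' i)) = g (Sum.inl i) + 1) ∧
      (¬ V i (τ' i) → g (Sum.inr (τ' i)) = g (Sum.inl i)))
    (Q : ℕ → Prop) :
    (univ.filter fun i : Fin m => V i (τ i) ∧ Q (g (Sum.inl i))).card =
      (univ.filter fun i : Fin m => V i (τ' i) ∧ Q (g (Sum.inl i))).card := by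
  classical
  set L := (univ.image fun i : Fin m => g (Sum.inl i)).filter Q with hL
  have hdec : ∀ σ : Equiv.Perm (Fin m),
      (univ.filter fun i : Fin m => V i (σ i) ∧ Q (g (Sum.inl i))) =
        L.biUnion fun ℓ => univ.filter fun i : Fin m => V i (σ i) ∧ g (Sum.inl i) = ℓ := by
    intro σ
    ext i
    simp only [hL, Finset.mem_filter, Finset.mem_univ, true_and, Finset.mem_biUnion,
      Finset.mem_image]
    constructor
    · rintro ⟨h1, h2⟩
      exact ⟨g (Sum.inl i), ⟨⟨i, rfl⟩, h2⟩, h1, rfl⟩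
    · rintro ⟨ℓ, ⟨-, h2⟩, h1, h3⟩
      exact ⟨h1, h3 ▸ h2⟩
  have hdisj : ∀ σ : Equiv.Perm (Fin m), (L : Set ℕ).PairwiseDisjoint fun ℓ =>
      univ.filter fun i : Fin m => V i (σ i) ∧ g (Sum.inl i) = ℓ := by
    intro σ ℓ _ ℓ' _ hne
    refine Finset.disjoint_filter.2 fun i _ h1 h2 => hne (h1.2.symm.trans h2.2)
  rw [hdec τ, hdec τ', Finset.card_biUnion (hdisj τ), Finset.card_biUnion (hdisj τ')]
  exact Finset.sum_congr rfl fun ℓ _ => card_level_var_eq V g τ τ' hτ hτ' ℓ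

end Summit.ValiantsHypothesis.ValiantsHypothesis.Theorems.PolyaContinuedMonotoneCoverHard
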